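import Summits.Ventures.HodgeRepro.Tier3WeilLineScalars
import Summits.Ventures.HodgeRepro.Tier3ProjectorCorrespondence

/-!
# The Weil line is a `K`-vector space through `act` — the module axioms of §4(d) on the kernel

Blind re-derivation cell `pub-hodge-repro`, seat `t3-p4` (Tier 3, T3.5 for T3.4 = Lemma R).  Target tree path
`lean/Summits/Ventures/HodgeRepro/Tier3WeilLineModule.lean`; imports the cell's `Tier3WeilLineScalars` and
`Tier3ProjectorCorrespondence`.

WHAT THIS FILE STATES (LEMMA-R-RESIDUE.md §4(d), first sentence: «for `a ∈ F` let `act(a) := α(a, 1, …, 1)^*` restricted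
to `K` … it is `ℚ`-linear and additive and multiplicative in `a` (§3), so `K` — and its `R`-stable subspace
`W_F(B) = e·K` — is an `F`-vector space»).  On the kernel `act(a) = ⋀^n(A′ (a at i₀, 1 elsewhere))` with
`A′ b = (ω′_i ↦ b_i • ω′_i)` (`Tier3LemmaRGenerator` / `Tier3LemmaRCorrespondence`), and the module axioms of the
`K`-structure of the Weil line `W_F` under `act` are:

* `weil_act_one` — `act(1) = id` (everywhere);
* `weil_act_mul` — `act(a b) = act(a) ∘ act(b)` (everywhere; `Tier3ProjectorCorrespondence.diag_comp_diag` +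
  `exteriorPower.map_comp`, with `update 1 i₀ a * update 1 i₀ b = update 1 i₀ (a b)`);
* `weil_act_add_of_mem` / `weil_act_zero_of_mem` — `act(a + b) w = act(a) w + act(b) w` and `act(0) w = 0` for `w ∈ W_F`,
  through the restriction-of-scalars map `q` (`Tier3WeilLineScalars.restrictScalars_map_update`: `q ∘ act(a) = a • q`),
  `q` injective on `W_F` and `W_F` `act`-stable (`Tier3WeilLineRestriction.weil_line_restrictScalars` (4) and the
  rank-one clause of `Tier3LemmaRCorrespondence.exists_weil_line_correspondence`);
* `weil_act_mem_of_generator` / `weil_act_mem_of_mem_of_generator` — the `act`-stability of `W_F` from LEMMA R's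
  generator clause alone (`Tier3LemmaRGeneratorScalars.exists_weil_line_generator_scalars`: `W_F` onto `⋀[K]^n V`,
  `q w₀ ≠ 0`, every `x ∈ W_F` is `act(a) w₀`): `act(a) w₀ ∈ W_F`, hence `act(a) w ∈ W_F` for every `w ∈ W_F`.

HONESTY — the reason the additivity is stated on `W_F` only.  `act(a) = ⋀^n(A′ (a at i₀, 1 elsewhere))` is NOT additive
in `a` on the whole of `⋀[F₀]^n V`: on a wedge carrying two vectors of the corner `i₀` it has degree two in `a`
(`K = ℚ(i)`, `ω′` the generator of the corner: `act(a)(ω′ ∧ i ω′) = N(a) · (ω′ ∧ i ω′)` with `N` the norm), which is exactly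
why §4(d) defines `act(a)` «restricted to `K`» = the Künneth component `⊗_i H¹(A_{T_i})` (one vector per corner) — there, and
a fortiori on `W_F ⊂ K`, `act(a)` is `ι_1(a)^* ⊗ 1 ⊗ ⋯ ⊗ 1`, additive in `a`.  Through Deligne's identification
`q|_{W_F} : W_F ≅ ∧^n_K V` the `K`-structure so obtained is the natural one (`q ∘ act(a) = a • q`, v15 §20), so these
axioms are the statement that `q|_{W_F}` is a `K`-LINEAR isomorphism `(W_F, act) ≅ ∧^{2p}_F H¹(B, ℚ)`.  Nothing
mathematical moves (LEMMA-R-RESIDUE v15: residue 0 unchanged); linear algebra on the cell's own modules and Mathlib;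
no definition is introduced; nothing geometric is built.  HC_CM is NOT proved by anyone in this repository.
-/

set_option autoImplicit false

open TensorProduct Finset

namespace HodgeRepro.Tier3

open HodgeRepro.RouteC

section Update

variable {K : Type*} [Field K] {ι : Type*} [DecidableEq ι]

/-- `(a at i₀, 1 elsewhere) · (b at i₀, 1 elsewhere) = (a b at i₀, 1 elsewhere)`. -/
theorem update_one_mul_update_one (i₀ : ι) (a b : K) :
    (Function.update (fun _ => (1 : K)) i₀ a) * (Function.update (fun _ => (1 : K)) i₀ b) =
      Function.update (fun _ => (1 : K)) i₀ (a * b) := by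
  funext i
  by_cases h : i = i₀
  · subst h
    simp only [Pi.mul_apply, Function.update_self]
  · simp only [Pi.mul_apply, Function.update_of_ne h, mul_one]

end Update

section Everywhere

variable {F₀ K : Type*} [Field F₀] [Field K] [Algebra F₀ K]
variable {V : Type*} [AddCommGroup V] [Module K V] [Module F₀ V] [IsScalarTower F₀ K V]
variable {ι : Type*} [DecidableEq ι]

/-- **`act(1) = id`.** -/
theorem weil_act_one (n : ℕ) (ω' : Module.Basis ι K V) (i₀ : ι) (v : ⋀[F₀]^n V) :
    exteriorPower.map n
      ((ω'.constr K fun i => Function.update (fun _ => (1 : K)) i₀ (1 : K) i • ω' i).restrictScalars F₀) v = v := by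
  have h1 : (ω'.constr K fun i => Function.update (fun _ => (1 : K)) i₀ (1 : K) i • ω' i) = LinearMap.id := by
    refine ω'.ext fun i => ?_
    rw [Module.Basis.constr_basis, LinearMap.id_apply]
    by_cases h : i = i₀
    · subst h
      rw [Function.update_self, one_smul]
    · rw [Function.update_of_ne h, one_smul]
  rw [h1, LinearMap.restrictScalars_id, exteriorPower.map_id, LinearMap.id_apply]

/-- **`act(a b) = act(a) ∘ act(b)`** — the first corner's multiplications compose
(`Tier3ProjectorCorrespondence.diag_comp_diag` + `exteriorPower.map_comp`). -/
theorem weil_act_mul (n : ℕ) (ω' : Module.Basis ι K V) (i₀ : ι) (a b : K) (v : ⋀[F₀]^n V) :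
    exteriorPower.map n
        ((ω'.constr K fun i => Function.update (fun _ => (1 : K)) i₀ (a * b) i • ω' i).restrictScalars F₀) v =
      exteriorPower.map n
        ((ω'.constr K fun i => Function.update (fun _ => (1 : K)) i₀ a i • ω' i).restrictScalars F₀)
        (exteriorPower.map n
          ((ω'.constr K fun i => Function.update (fun _ => (1 : K)) i₀ b i • ω' i).restrictScalars F₀) v) := by
  rw [← LinearMap.comp_apply (exteriorPower.map n _) (exteriorPower.map n _), ← exteriorPower.map_comp,
    diag_comp_diag, update_one_mul_update_one]

end Everywhere

section OnTheWeilLine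

variable {F₀ K : Type*} [Field F₀] [Field K] [Algebra F₀ K]
variable {V : Type*} [AddCommGroup V] [Module K V] [Module F₀ V] [IsScalarTower F₀ K V]
variable {ι : Type*} [Fintype ι] [LinearOrder ι]

/-- **`act(a + b) = act(a) + act(b)` on the Weil line**, through `q`: with `q ∘ act(a) = a • q`
(`restrictScalars_map_update`), `q` injective on `W_F` and `W_F` `act`-stable, for `w ∈ W_F`
`q (act(a + b) w − act(a) w − act(b) w) = (a + b) • q w − a • q w − b • q w = 0`, and the argument lies in `W_F`. -/
theorem weil_act_add_of_mem {n : ℕ} (hn : Fintype.card ι = n) (ω' : Module.Basis ι K V)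
    (q : ⋀[F₀]^n V →ₗ[F₀] ⋀[K]^n V)
    (hq : ∀ v : Fin n → V, q (exteriorPower.ιMulti F₀ n v) = exteriorPower.ιMulti K n v)
    (WF : Submodule F₀ (⋀[F₀]^n V)) (hinj : ∀ v ∈ WF, q v = 0 → v = 0) (i₀ : ι)
    (hstable : ∀ (a : K) (w : ⋀[F₀]^n V), w ∈ WF → exteriorPower.map n
      ((ω'.constr K fun i => Function.update (fun _ => (1 : K)) i₀ a i • ω' i).restrictScalars F₀) w ∈ WF)
    (a b : K) (w : ⋀[F₀]^n V) (hw : w ∈ WF) :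
    exteriorPower.map n
        ((ω'.constr K fun i => Function.update (fun _ => (1 : K)) i₀ (a + b) i • ω' i).restrictScalars F₀) w =
      exteriorPower.map n
        ((ω'.constr K fun i => Function.update (fun _ => (1 : K)) i₀ a i • ω' i).restrictScalars F₀) w +
      exteriorPower.map n
        ((ω'.constr K fun i => Function.update (fun _ => (1 : K)) i₀ b i • ω' i).restrictScalars F₀) w := by
  have hmem : exteriorPower.map n
      ((ω'.constr K fun i => Function.update (fun _ => (1 : K)) i₀ (a + b) i • ω' i).restrictScalars F₀) w -
      (exteriorPower.map n
        ((ω'.constr K fun i => Function.update (fun _ => (1 : K)) i₀ a i • ω' i).restrictScalars F₀) w +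
      exteriorPower.map n
        ((ω'.constr K fun i => Function.update (fun _ => (1 : K)) i₀ b i • ω' i).restrictScalars F₀) w) ∈ WF :=
    WF.sub_mem (hstable _ _ hw) (WF.add_mem (hstable _ _ hw) (hstable _ _ hw))
  have hq0 : q (exteriorPower.map n
      ((ω'.constr K fun i => Function.update (fun _ => (1 : K)) i₀ (a + b) i • ω' i).restrictScalars F₀) w -
      (exteriorPower.map n
        ((ω'.constr K fun i => Function.update (fun _ => (1 : K)) i₀ a i • ω' i).restrictScalars F₀) w +
      exteriorPower.map n
        ((ω'.constr K fun i => Function.update (fun _ => (1 : K)) i₀ b i • ω' i).restrictScalars F₀) w)) = 0 := by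
    rw [map_sub, map_add, restrictScalars_map_update hn ω' q hq, restrictScalars_map_update hn ω' q hq,
      restrictScalars_map_update hn ω' q hq, add_smul, sub_self]
  exact sub_eq_zero.mp (hinj _ hmem hq0)

/-- **`act(0) = 0` on the Weil line**, through `q`. -/
theorem weil_act_zero_of_mem {n : ℕ} (hn : Fintype.card ι = n) (ω' : Module.Basis ι K V)
    (q : ⋀[F₀]^n V →ₗ[F₀] ⋀[K]^n V)
    (hq : ∀ v : Fin n → V, q (exteriorPower.ιMulti F₀ n v) = exteriorPower.ιMulti K n v)
    (WF : Submodule F₀ (⋀[F₀]^n V)) (hinj : ∀ v ∈ WF, q v = 0 → v = 0) (i₀ : ι)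
    (hstable : ∀ (a : K) (w : ⋀[F₀]^n V), w ∈ WF → exteriorPower.map n
      ((ω'.constr K fun i => Function.update (fun _ => (1 : K)) i₀ a i • ω' i).restrictScalars F₀) w ∈ WF)
    (w : ⋀[F₀]^n V) (hw : w ∈ WF) :
    exteriorPower.map n
      ((ω'.constr K fun i => Function.update (fun _ => (1 : K)) i₀ (0 : K) i • ω' i).restrictScalars F₀) w = 0 := by
  refine hinj _ (hstable 0 w hw) ?_
  rw [restrictScalars_map_update hn ω' q hq, zero_smul]

/-- **`act(a) w₀ ∈ W_F` from LEMMA R's generator clause**: if `W_F` maps onto `⋀[K]^n V`, `q w₀ ≠ 0` and every `x ∈ W_F` is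
`act(c) w₀`, then `act(a) w₀ ∈ W_F` — take `v ∈ W_F` with `q v = a • q w₀`, write `v = act(c) w₀`, so
`c • q w₀ = a • q w₀`, `c = a`, and `act(a) w₀ = v`. -/
theorem weil_act_mem_of_generator {n : ℕ} (hn : Fintype.card ι = n) (ω' : Module.Basis ι K V)
    (q : ⋀[F₀]^n V →ₗ[F₀] ⋀[K]^n V)
    (hq : ∀ v : Fin n → V, q (exteriorPower.ιMulti F₀ n v) = exteriorPower.ιMulti K n v)
    (WF : Submodule F₀ (⋀[F₀]^n V)) (honto : ∀ y : ⋀[K]^n V, ∃ v ∈ WF, q v = y) (i₀ : ι)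
    (w₀ : ⋀[F₀]^n V) (hw₀q : q w₀ ≠ 0)
    (hgen : ∀ x ∈ WF, ∃ c : K, x = exteriorPower.map n
      ((ω'.constr K fun i => Function.update (fun _ => (1 : K)) i₀ c i • ω' i).restrictScalars F₀) w₀)
    (a : K) :
    exteriorPower.map n
      ((ω'.constr K fun i => Function.update (fun _ => (1 : K)) i₀ a i • ω' i).restrictScalars F₀) w₀ ∈ WF := by
  obtain ⟨v, hvW, hvq⟩ := honto (a • q w₀)
  obtain ⟨c, hvc⟩ := hgen v hvW
  have hca : c = a := by
    have h1 : c • q w₀ = a • q w₀ := by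
      rw [← hvq, hvc, restrictScalars_map_update hn ω' q hq]
    have h2 : (c - a) • q w₀ = 0 := by
      have h3 := sub_smul c a (q w₀)
      rw [h3, h1, sub_self]
    exact sub_eq_zero.mp ((smul_eq_zero.mp h2).resolve_right hw₀q)
  rw [← hca, ← hvc]
  exact hvW

/-- **`W_F` is `act`-stable from LEMMA R's generator clause**: `w = act(b) w₀ ⇒ act(a) w = act(a b) w₀ ∈ W_F`. -/
theorem weil_act_mem_of_mem_of_generator {n : ℕ} (hn : Fintype.card ι = n) (ω' : Module.Basis ι K V)
    (q : ⋀[F₀]^n V →ₗ[F₀] ⋀[K]^n V)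
    (hq : ∀ v : Fin n → V, q (exteriorPower.ιMulti F₀ n v) = exteriorPower.ιMulti K n v)
    (WF : Submodule F₀ (⋀[F₀]^n V)) (honto : ∀ y : ⋀[K]^n V, ∃ v ∈ WF, q v = y) (i₀ : ι)
    (w₀ : ⋀[F₀]^n V) (hw₀q : q w₀ ≠ 0)
    (hgen : ∀ x ∈ WF, ∃ c : K, x = exteriorPower.map n
      ((ω'.constr K fun i => Function.update (fun _ => (1 : K)) i₀ c i • ω' i).restrictScalars F₀) w₀)
    (a : K) (w : ⋀[F₀]^n V) (hw : w ∈ WF) :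
    exteriorPower.map n
      ((ω'.constr K fun i => Function.update (fun _ => (1 : K)) i₀ a i • ω' i).restrictScalars F₀) w ∈ WF := by
  obtain ⟨b, hwb⟩ := hgen w hw
  rw [hwb, ← weil_act_mul]
  exact weil_act_mem_of_generator hn ω' q hq WF honto i₀ w₀ hw₀q hgen (a * b)

end OnTheWeilLine

end HodgeRepro.Tier3
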